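import Literature.NumberTheory.LFunctions.DirichletLGammaShiftRatio
import Literature.NumberTheory.LFunctions.ConreyIwaniec2002AFELineIntegrals
import Literature.NumberTheory.LFunctions.AFEHarmonicSums
import Literature.NumberTheory.Sieve.GoldstonPintzYildirimEulerProduct
import HarnessLib

/-!
# The kernel `V` of the smooth approximate functional equation for Dirichlet `L`-functions:
# Stirling class of `Γ(w + u/2)/Γ(w)`, the two bounds for `V`, and the summation `Σ n^{-1/2}|V| ≪ √N₀`

Topic `Literature/NumberTheory/LFunctions`. Everything here is PROVED (no definitions, no named facts).

For `w ∈ ℂ` with `1/4 ≤ Re w ≤ 3/4` (in the application `w = (s+𝔞)/2`, `Re s = ½`, `𝔞 ∈ {0,1}`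
the parity of the character) and `y > 0` the kernel of the smooth approximate functional equation
with test function `G(u) = e^{u²}` is

  `V(w, y) = (1/2π) ∫ h_w(u) e^{u²} y^{-u} u^{-1} dv`,  `u = 3/4 + iv`,  `h_w(u) = Γ(w + u/2)/Γ(w)`

(written throughout as this explicit integral; `y^{-u} = (q/π)^{u/2} n^{-u}` for `y = n √(π/q)`).
We prove, with absolute constants:

* `exists_norm_hfun_le` — `h_w` is of Stirling class: `‖h_w(u)‖ ≤ C ‖w‖^{Re u/2}(1+|Im u|)^7 e^{π|Im u|/2}`
  for `−1/4 ≤ Re u ≤ 6` (the tree's `DirichletConvexity.exists_norm_Gamma_add_div_le`);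
* `exists_V_bounds` — `‖V(w,y)‖ ≤ K ‖w‖^{3/8} y^{-3/4}` (the line `Re u = 3/4`) and
  `‖V(w,y)‖ ≤ 1 + K ‖w‖^{-1/8} y^{1/4}` (shift to `Re u = −1/4` across the pole `u = 0`, residue
  `h_w(0) = 1`), by the Gaussian line-integral machinery `ConreyIwaniec2002.AFEKernel.*`;
* `exists_tsum_term_le` — for `|a(n)| ≤ 1`, `Re s = ½`, `q ≥ 1`:
  `Σ_n ‖a(n) V(w, n√(π/q)) n^{-s}‖ ≤ C (q ‖w‖)^{1/4}` (split at `N₀ = (‖w‖ q/π)^{1/2}`: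
  `Σ_{n ≤ N₀} n^{-1/2} ≤ 2√N₀`, `Σ_{n > N₀} n^{-5/4} ≪ N₀^{-1/4}`).

These are Proposition 5.4 and the estimate (5.20) of [IwaniecKowalski2004] for degree one (there
`V_s(y) ≪ (1 + y/√𝔮_∞)^{-A}`, `G` a general test function): the trivial estimation of the
approximate functional equation that yields the convexity bound without logarithm.

## References
* [IwaniecKowalski2004] H. Iwaniec, E. Kowalski, *Analytic Number Theory*, AMS Coll. Publ. 53
  (2004), §5.2: Theorem 5.3, Proposition 5.4, (5.20).
-/

noncomputable section

open Complex MeasureTheory Real Set Filter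
open scoped Topology

namespace Literature.NumberTheory.LFunctions.DirichletConvexity

open Literature.NumberTheory.LFunctions.ConreyIwaniec2002.AFEKernel (norm_integral_lineF_le
  integral_lineF_one_sub_eq integrable_lineF)

/-! ### §1. The numerator `h_w(u) = Γ(w + u/2)/Γ(w)` -/

/-- `h_w(0) = 1` (for `Re w > 0`). [cite: IwaniecKowalski2004, Proposition 5.4 (proof)] -/
theorem hfun_zero {w : ℂ} (hw : 0 < w.re) :
    (fun u : ℂ => Complex.Gamma (w + u / 2) / Complex.Gamma w) 0 = 1 := by
  simp [Complex.Gamma_ne_zero_of_re_pos hw]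

/-- `h_w` is holomorphic on `Re u ≥ −1/4` when `Re w ≥ 1/4` (then `Re(w + u/2) ≥ 1/8 > 0`).
[cite: IwaniecKowalski2004, Proposition 5.4 (proof)] -/
theorem differentiableOn_hfun {w : ℂ} (hw : 1 / 4 ≤ w.re) {a b : ℝ} (ha : -1 / 4 ≤ a) :
    DifferentiableOn ℂ (fun u : ℂ => Complex.Gamma (w + u / 2) / Complex.Gamma w)
      (re ⁻¹' Icc a b) := by
  intro u hu
  have hu' : a ≤ u.re := (by simpa using hu : a ≤ u.re ∧ u.re ≤ b).1
  refine DifferentiableAt.differentiableWithinAt ?_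
  refine DifferentiableAt.div_const ?_ _
  refine (Complex.differentiableAt_Gamma _ fun m hm => ?_).comp u ?_
  · have := congrArg Complex.re hm
    simp at this
    have h0 : (0 : ℝ) ≤ m := Nat.cast_nonneg m
    linarith
  · exact (differentiableAt_const _).add (differentiableAt_id.div_const _)

/-- **Stirling class of `h_w`**: an absolute `C` with
`‖Γ(w + u/2)/Γ(w)‖ ≤ C ‖w‖^{Re u/2} (1 + |Im u|)^7 e^{π|Im u|/2}` for `1/4 ≤ Re w ≤ 3/4`,
`−1/4 ≤ Re u ≤ 6`. [cite: IwaniecKowalski2004, Proposition 5.4 (proof)] -/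
theorem exists_norm_hfun_le :
    ∃ C : ℝ, 0 < C ∧ ∀ w : ℂ, 1 / 4 ≤ w.re → w.re ≤ 3 / 4 → ∀ u : ℂ, -1 / 4 ≤ u.re → u.re ≤ 6 →
      ‖Complex.Gamma (w + u / 2) / Complex.Gamma w‖ ≤
        C * ‖w‖ ^ (u.re / 2) * (1 + |u.im|) ^ 7 * Real.exp (π * |u.im| / 2) := by
  obtain ⟨C, hC, h⟩ := exists_norm_Gamma_add_div_le
  refine ⟨C, hC, fun w hw1 hw2 u hu1 hu2 => ?_⟩
  have key := h w (u / 2) hw1 hw2 (by simp; linarith) (by simp; linarith)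
  have hre : (u / 2).re = u.re / 2 := by simp
  have him : (u / 2).im = u.im / 2 := by simp
  rw [hre, him] at key
  refine key.trans ?_
  have hw0 : 0 ≤ C * ‖w‖ ^ (u.re / 2) := by positivity
  have h1 : (1 + |u.im / 2|) ^ 7 ≤ (1 + |u.im|) ^ 7 := by
    have : |u.im / 2| ≤ |u.im| := by
      rw [abs_div, show |(2:ℝ)| = 2 by norm_num]; linarith [abs_nonneg u.im]
    exact pow_le_pow_left₀ (by positivity) (by linarith) 7
  have h2 : Real.exp (π * |u.im / 2| / 2) ≤ Real.exp (π * |u.im| / 2) := by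
    apply Real.exp_le_exp.2
    rw [abs_div, show |(2:ℝ)| = 2 by norm_num]
    nlinarith [Real.pi_pos, abs_nonneg u.im]
  calc C * ‖w‖ ^ (u.re / 2) * (1 + |u.im / 2|) ^ 7 * Real.exp (π * |u.im / 2| / 2)
      ≤ C * ‖w‖ ^ (u.re / 2) * (1 + |u.im|) ^ 7 * Real.exp (π * |u.im| / 2) := by
        gcongr

/-- `‖w‖^x ≤ ‖w‖^{-1/8} + ‖w‖^{3/8}` for `−1/8 ≤ x ≤ 3/8` (`‖w‖ > 0`). [folklore] -/
private theorem rpow_le_add {W x : ℝ} (hW : 0 < W) (h1 : -(1 / 8) ≤ x) (h2 : x ≤ 3 / 8) :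
    W ^ x ≤ W ^ (-(1 / 8) : ℝ) + W ^ (3 / 8 : ℝ) := by
  rcases le_or_gt 1 W with hW1 | hW1
  · have := Real.rpow_le_rpow_of_exponent_le hW1 h2
    linarith [Real.rpow_nonneg hW.le (-(1 / 8) : ℝ)]
  · have := Real.rpow_le_rpow_of_exponent_ge hW hW1.le h1
    linarith [Real.rpow_nonneg hW.le (3 / 8 : ℝ)]

/-! ### §2. The two bounds for `V(w, y)` -/

/-- **The two bounds for the kernel** `V(w,y) = (1/2π)∫ h_w(u) e^{u²} y^{-u} u^{-1} dv`
(`u = 3/4 + iv`): an absolute `K` with `‖V(w,y)‖ ≤ K ‖w‖^{3/8} y^{-3/4}` and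
`‖V(w,y)‖ ≤ 1 + K ‖w‖^{-1/8} y^{1/4}` for `1/4 ≤ Re w ≤ 3/4`, `y > 0` (the second by moving the
line to `Re u = −1/4` across the simple pole at `u = 0` with residue `h_w(0) = 1`).
[cite: IwaniecKowalski2004, Proposition 5.4] -/
theorem exists_V_bounds :
    ∃ K : ℝ, 0 < K ∧ ∀ w : ℂ, 1 / 4 ≤ w.re → w.re ≤ 3 / 4 → ∀ y : ℝ, 0 < y →
      ‖(1 / (2 * π) : ℂ) * ∫ v : ℝ,
          (fun u : ℂ => Complex.Gamma (w + u / 2) / Complex.Gamma w) (((3 / 4 : ℝ) : ℂ) + v * I) *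
            cexp ((((3 / 4 : ℝ) : ℂ) + v * I) ^ 2) * (y : ℂ) ^ (-(((3 / 4 : ℝ) : ℂ) + v * I)) /
            (((3 / 4 : ℝ) : ℂ) + v * I)‖ ≤ K * ‖w‖ ^ (3 / 8 : ℝ) * y ^ (-(3 / 4 : ℝ)) ∧
      ‖(1 / (2 * π) : ℂ) * ∫ v : ℝ,
          (fun u : ℂ => Complex.Gamma (w + u / 2) / Complex.Gamma w) (((3 / 4 : ℝ) : ℂ) + v * I) *
            cexp ((((3 / 4 : ℝ) : ℂ) + v * I) ^ 2) * (y : ℂ) ^ (-(((3 / 4 : ℝ) : ℂ) + v * I)) /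
            (((3 / 4 : ℝ) : ℂ) + v * I)‖ ≤ 1 + K * ‖w‖ ^ (-(1 / 8) : ℝ) * y ^ (1 / 4 : ℝ) := by
  obtain ⟨C, hC, hh⟩ := exists_norm_hfun_le
  -- the constant: `(1/2π) · C e^{c² + 81/2} √(2π) / |c|` with `c ∈ {3/4, −1/4}`; use the larger one
  set K : ℝ := 1 / (2 * π) * (C * Real.exp ((3 / 4 : ℝ) ^ 2 + ((7 : ℝ) + 2) ^ 2 / 2) *
    Real.sqrt (2 * π)) / (1 / 4) with hK
  have hK0 : 0 < K := by rw [hK]; positivity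
  refine ⟨K, hK0, fun w hw1 hw2 y hy => ?_⟩
  have hwre : 0 < w.re := by linarith
  have hw0 : 0 < ‖w‖ := norm_pos_iff.2 fun h => by rw [h] at hwre; simp at hwre
  set h : ℂ → ℂ := fun u : ℂ => Complex.Gamma (w + u / 2) / Complex.Gamma w with hhdef
  have hπ : ‖(1 / (2 * π) : ℂ)‖ = 1 / (2 * π) := by
    rw [norm_div, norm_one, norm_mul, Complex.norm_real, Real.norm_eq_abs,
      abs_of_pos Real.pi_pos, show ‖(2 : ℂ)‖ = 2 by norm_num]
  -- Stirling class on the lines and on the strip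
  have hline : ∀ c : ℝ, -1 / 4 ≤ c → c ≤ 6 → ∀ v : ℝ,
      ‖h ((c : ℂ) + v * I)‖ ≤ C * ‖w‖ ^ (c / 2) * (1 + |v|) ^ 7 * Real.exp (π * |v| / 2) := by
    intro c hc1 hc2 v
    have := hh w hw1 hw2 ((c : ℂ) + v * I) (by simp; linarith) (by simp; exact hc2)
    simpa [hhdef] using this
  have hstrip : ∀ u : ℂ, -(1 / 4) ≤ u.re → u.re ≤ 3 / 4 →
      ‖h u‖ ≤ C * (‖w‖ ^ (-(1 / 8) : ℝ) + ‖w‖ ^ (3 / 8 : ℝ)) * (1 + |u.im|) ^ 7 *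
        Real.exp (π * |u.im| / 2) := by
    intro u hu1 hu2
    have h1 := hh w hw1 hw2 u (by linarith) (by linarith)
    refine h1.trans ?_
    have h2 : ‖w‖ ^ (u.re / 2) ≤ ‖w‖ ^ (-(1 / 8) : ℝ) + ‖w‖ ^ (3 / 8 : ℝ) :=
      rpow_le_add hw0 (by linarith) (by linarith)
    have h3 : 0 ≤ (1 + |u.im|) ^ 7 * Real.exp (π * |u.im| / 2) := by positivity
    calc C * ‖w‖ ^ (u.re / 2) * (1 + |u.im|) ^ 7 * Real.exp (π * |u.im| / 2)
        = C * ‖w‖ ^ (u.re / 2) * ((1 + |u.im|) ^ 7 * Real.exp (π * |u.im| / 2)) := by ring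
      _ ≤ C * (‖w‖ ^ (-(1 / 8) : ℝ) + ‖w‖ ^ (3 / 8 : ℝ)) *
            ((1 + |u.im|) ^ 7 * Real.exp (π * |u.im| / 2)) := by gcongr
      _ = _ := by ring
  constructor
  · -- the line `Re u = 3/4`
    have hb := norm_integral_lineF_le (h := h) (c := 3 / 4) (M := C * ‖w‖ ^ ((3 / 4 : ℝ) / 2))
      (n := 7) (k := 1) hy (Or.inr (by norm_num)) (hline (3 / 4) (by norm_num) (by norm_num))
    simp only [pow_one] at hb
    rw [norm_mul, hπ]
    have e34 : ((3 / 4 : ℝ) / 2) = (3 / 8 : ℝ) := by norm_num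
    rw [e34, show |(3 / 4 : ℝ)| = 3 / 4 by norm_num] at hb
    calc 1 / (2 * π) * ‖∫ v : ℝ, h (((3 / 4 : ℝ) : ℂ) + v * I) *
          cexp ((((3 / 4 : ℝ) : ℂ) + v * I) ^ 2) * (y : ℂ) ^ (-(((3 / 4 : ℝ) : ℂ) + v * I)) /
          (((3 / 4 : ℝ) : ℂ) + v * I)‖
        ≤ 1 / (2 * π) * (C * ‖w‖ ^ (3 / 8 : ℝ) * Real.exp ((3 / 4 : ℝ) ^ 2 + ((7 : ℕ) + 2 : ℝ) ^ 2 / 2) *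
            Real.sqrt (2 * π) * y ^ (-(3 / 4 : ℝ)) / (3 / 4)) :=
          mul_le_mul_of_nonneg_left hb (by positivity)
      _ ≤ K * ‖w‖ ^ (3 / 8 : ℝ) * y ^ (-(3 / 4 : ℝ)) := by
          rw [hK]; push_cast
          have hpos : 0 ≤ C * ‖w‖ ^ (3 / 8 : ℝ) * Real.exp ((3 / 4 : ℝ) ^ 2 + ((7 : ℝ) + 2) ^ 2 / 2) *
            Real.sqrt (2 * π) * y ^ (-(3 / 4 : ℝ)) := by positivity
          have : 1 / (2 * π) * (C * ‖w‖ ^ (3 / 8 : ℝ) * Real.exp ((3 / 4 : ℝ) ^ 2 + ((7 : ℝ) + 2) ^ 2 / 2) *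
              Real.sqrt (2 * π) * y ^ (-(3 / 4 : ℝ)) / (3 / 4)) ≤
              1 / (2 * π) * (C * ‖w‖ ^ (3 / 8 : ℝ) * Real.exp ((3 / 4 : ℝ) ^ 2 + ((7 : ℝ) + 2) ^ 2 / 2) *
              Real.sqrt (2 * π) * y ^ (-(3 / 4 : ℝ)) / (1 / 4)) := by
            apply mul_le_mul_of_nonneg_left _ (by positivity)
            exact div_le_div_of_nonneg_left hpos (by norm_num) (by norm_num)
          refine this.trans (le_of_eq ?_)
          ring
  · -- shift to `Re u = -1/4`: residue `h(0) = 1`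
    have hshift := integral_lineF_one_sub_eq (h := h) (a := -(1 / 4)) (b := 3 / 4)
      (M := C * (‖w‖ ^ (-(1 / 8) : ℝ) + ‖w‖ ^ (3 / 8 : ℝ))) (n := 7) (by norm_num) (by norm_num) hy
      (differentiableOn_hfun hw1 (by norm_num)) hstrip
    have h0 : h 0 = 1 := by simp [hhdef, Complex.Gamma_ne_zero_of_re_pos hwre]
    rw [h0] at hshift
    -- `∫_{3/4} = 2π + ∫_{-1/4}`
    have heq : (∫ v : ℝ, h (((3 / 4 : ℝ) : ℂ) + v * I) *
          cexp ((((3 / 4 : ℝ) : ℂ) + v * I) ^ 2) * (y : ℂ) ^ (-(((3 / 4 : ℝ) : ℂ) + v * I)) /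
          (((3 / 4 : ℝ) : ℂ) + v * I)) = 2 * π * 1 +
        ∫ v : ℝ, h (((-(1 / 4) : ℝ) : ℂ) + v * I) *
          cexp ((((-(1 / 4) : ℝ) : ℂ) + v * I) ^ 2) * (y : ℂ) ^ (-(((-(1 / 4) : ℝ) : ℂ) + v * I)) /
          (((-(1 / 4) : ℝ) : ℂ) + v * I) := by
      linear_combination hshift
    have hb := norm_integral_lineF_le (h := h) (c := -(1 / 4)) (M := C * ‖w‖ ^ ((-(1 / 4) : ℝ) / 2))
      (n := 7) (k := 1) hy (Or.inr (by norm_num)) (hline (-(1 / 4)) (by norm_num) (by norm_num))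
    simp only [pow_one] at hb
    rw [show ((-(1 / 4) : ℝ) / 2) = (-(1 / 8) : ℝ) by norm_num,
      show |(-(1 / 4) : ℝ)| = 1 / 4 by norm_num, show -(-(1 / 4) : ℝ) = (1 / 4 : ℝ) by norm_num] at hb
    have hfirst : ‖(1 / (2 * π) : ℂ) * (2 * π * 1)‖ = 1 := by
      rw [norm_mul, hπ]
      rw [show ((2 : ℂ) * π * 1) = ((2 * π : ℝ) : ℂ) by push_cast; ring, Complex.norm_real,
        Real.norm_eq_abs, abs_of_pos (by positivity)]
      field_simp
    rw [heq, mul_add]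
    refine (norm_add_le _ _).trans ?_
    rw [hfirst, norm_mul, hπ]
    gcongr 1 + ?_
    calc 1 / (2 * π) * ‖∫ v : ℝ, h (((-(1 / 4) : ℝ) : ℂ) + v * I) *
          cexp ((((-(1 / 4) : ℝ) : ℂ) + v * I) ^ 2) * (y : ℂ) ^ (-(((-(1 / 4) : ℝ) : ℂ) + v * I)) /
          (((-(1 / 4) : ℝ) : ℂ) + v * I)‖
        ≤ 1 / (2 * π) * (C * ‖w‖ ^ (-(1 / 8) : ℝ) *
            Real.exp ((-(1 / 4) : ℝ) ^ 2 + ((7 : ℕ) + 2 : ℝ) ^ 2 / 2) *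
            Real.sqrt (2 * π) * y ^ (1 / 4 : ℝ) / (1 / 4)) :=
          mul_le_mul_of_nonneg_left hb (by positivity)
      _ ≤ K * ‖w‖ ^ (-(1 / 8) : ℝ) * y ^ (1 / 4 : ℝ) := by
          rw [hK]; push_cast
          have hexp : Real.exp ((-(1 / 4) : ℝ) ^ 2 + ((7 : ℝ) + 2) ^ 2 / 2) ≤
              Real.exp ((3 / 4 : ℝ) ^ 2 + ((7 : ℝ) + 2) ^ 2 / 2) :=
            Real.exp_le_exp.2 (by norm_num)
          have hpos : 0 ≤ 1 / (2 * π) * (C * ‖w‖ ^ (-(1 / 8) : ℝ)) * Real.sqrt (2 * π) *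
              y ^ (1 / 4 : ℝ) / (1 / 4) := by positivity
          calc 1 / (2 * π) * (C * ‖w‖ ^ (-(1 / 8) : ℝ) *
                Real.exp ((-(1 / 4) : ℝ) ^ 2 + ((7 : ℝ) + 2) ^ 2 / 2) * Real.sqrt (2 * π) *
                y ^ (1 / 4 : ℝ) / (1 / 4))
              = (1 / (2 * π) * (C * ‖w‖ ^ (-(1 / 8) : ℝ)) * Real.sqrt (2 * π) * y ^ (1 / 4 : ℝ) /
                  (1 / 4)) * Real.exp ((-(1 / 4) : ℝ) ^ 2 + ((7 : ℝ) + 2) ^ 2 / 2) := by ring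
            _ ≤ (1 / (2 * π) * (C * ‖w‖ ^ (-(1 / 8) : ℝ)) * Real.sqrt (2 * π) * y ^ (1 / 4 : ℝ) /
                  (1 / 4)) * Real.exp ((3 / 4 : ℝ) ^ 2 + ((7 : ℝ) + 2) ^ 2 / 2) :=
                mul_le_mul_of_nonneg_left hexp hpos
            _ = _ := by ring

/-! ### §3. The summation `Σ_n n^{-1/2} |V| ≪ √N₀` -/

/-- **Trivial estimation of one sum of the approximate functional equation.** If `|a(n)| ≤ 1` and
the weights satisfy `|V(n)| ≤ K W^{3/8} (nρ)^{-3/4}` and `|V(n)| ≤ 1 + K W^{-1/8} (nρ)^{1/4}`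
(`n ≥ 1`; so `|V(n)| ≤ 1 + K` for `n ≤ N₀ = W^{1/2}/ρ` and `|V(n)| ≤ K (N₀/n)^{3/4}` beyond), then on
`Re s = ½` the series `Σ a(n) V(n) n^{-s}` converges absolutely and
`Σ_n |a(n) V(n) n^{-s}| ≤ (2 + 10K) √N₀ = (2 + 10K) W^{1/4} ρ^{-1/2}`.
[cite: IwaniecKowalski2004, (5.20)] -/
theorem tsum_norm_term_le_of_bounds {K W ρ : ℝ} (hK : 0 ≤ K) (hW : 0 < W) (hρ : 0 < ρ)
    {a : ℕ → ℂ} (ha : ∀ n, ‖a n‖ ≤ 1) {V : ℕ → ℂ}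
    (hV1 : ∀ n : ℕ, 1 ≤ n → ‖V n‖ ≤ K * W ^ (3 / 8 : ℝ) * ((n : ℝ) * ρ) ^ (-(3 / 4) : ℝ))
    (hV2 : ∀ n : ℕ, 1 ≤ n → ‖V n‖ ≤ 1 + K * W ^ (-(1 / 8) : ℝ) * ((n : ℝ) * ρ) ^ (1 / 4 : ℝ))
    {s : ℂ} (hs : s.re = 1 / 2) :
    Summable (fun n => ‖LSeries.term (fun n => a n * V n) s n‖) ∧
    ∑' n, ‖LSeries.term (fun n => a n * V n) s n‖ ≤
      (2 + 10 * K) * (W ^ (1 / 4 : ℝ) * ρ ^ (-(1 / 2) : ℝ)) := by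
  -- `N₀ = W^{1/2}/ρ`, `√N₀ = W^{1/4} ρ^{-1/2}`
  set N₀ : ℝ := W ^ (1 / 2 : ℝ) / ρ with hN₀
  have hN₀0 : 0 < N₀ := div_pos (Real.rpow_pos_of_pos hW _) hρ
  have hsqrtN : Real.sqrt N₀ = W ^ (1 / 4 : ℝ) * ρ ^ (-(1 / 2) : ℝ) := by
    rw [hN₀, Real.sqrt_eq_rpow, Real.div_rpow (Real.rpow_nonneg hW.le _) hρ.le,
      ← Real.rpow_mul hW.le, Real.rpow_neg hρ.le, div_eq_mul_inv]
    norm_num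
  -- the two bounds in terms of `N₀`
  have hratio1 : ∀ n : ℕ, 1 ≤ n →
      W ^ (3 / 8 : ℝ) * ((n : ℝ) * ρ) ^ (-(3 / 4) : ℝ) = N₀ ^ (3 / 4 : ℝ) * (n : ℝ) ^ (-(3 / 4) : ℝ) := by
    intro n hn
    have hn0 : (0 : ℝ) < n := by exact_mod_cast hn
    rw [hN₀, Real.div_rpow (Real.rpow_nonneg hW.le _) hρ.le, ← Real.rpow_mul hW.le,
      Real.mul_rpow hn0.le hρ.le, Real.rpow_neg hρ.le]
    norm_num; ring
  have hratio2 : ∀ n : ℕ, 1 ≤ n →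
      W ^ (-(1 / 8) : ℝ) * ((n : ℝ) * ρ) ^ (1 / 4 : ℝ) = (n : ℝ) ^ (1 / 4 : ℝ) * N₀ ^ (-(1 / 4) : ℝ) := by
    intro n hn
    have hn0 : (0 : ℝ) < n := by exact_mod_cast hn
    rw [hN₀, Real.div_rpow (Real.rpow_nonneg hW.le _) hρ.le, ← Real.rpow_mul hW.le,
      Real.mul_rpow hn0.le hρ.le, Real.rpow_neg hρ.le]
    norm_num
    ring
  -- the general term
  set f : ℕ → ℝ := fun n => ‖LSeries.term (fun n => a n * V n) s n‖ with hf
  have hf0 : f 0 = 0 := by simp [hf]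
  have hfn : ∀ n : ℕ, 1 ≤ n → f n ≤ ‖V n‖ * (n : ℝ) ^ (-(1 / 2) : ℝ) := by
    intro n hn
    have hn0 : (0 : ℝ) < n := by exact_mod_cast hn
    simp only [hf]
    rw [LSeries.norm_term_eq, if_neg (by omega), norm_mul, hs, Real.rpow_neg hn0.le,
      div_eq_mul_inv]
    have hV0 : 0 ≤ ‖V n‖ := norm_nonneg _
    have : ‖a n‖ * ‖V n‖ ≤ 1 * ‖V n‖ := mul_le_mul_of_nonneg_right (ha n) hV0
    have hinv : 0 ≤ ((n : ℝ) ^ (1 / 2 : ℝ))⁻¹ := by positivity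
    nlinarith
  have hfnn : ∀ n, 0 ≤ f n := fun n => norm_nonneg _
  -- bound A: `f n ≤ K N₀^{3/4} n^{-5/4}` for all `n ≥ 1`
  have hA : ∀ n : ℕ, 1 ≤ n → f n ≤ K * N₀ ^ (3 / 4 : ℝ) * (n : ℝ) ^ (-(5 / 4) : ℝ) := by
    intro n hn
    have hn0 : (0 : ℝ) < n := by exact_mod_cast hn
    have h1 := hV1 n hn
    rw [mul_assoc, hratio1 n hn] at h1
    calc f n ≤ ‖V n‖ * (n : ℝ) ^ (-(1 / 2) : ℝ) := hfn n hn
      _ ≤ (K * (N₀ ^ (3 / 4 : ℝ) * (n : ℝ) ^ (-(3 / 4) : ℝ))) * (n : ℝ) ^ (-(1 / 2) : ℝ) :=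
          mul_le_mul_of_nonneg_right h1 (Real.rpow_nonneg hn0.le _)
      _ = K * N₀ ^ (3 / 4 : ℝ) * ((n : ℝ) ^ (-(3 / 4) : ℝ) * (n : ℝ) ^ (-(1 / 2) : ℝ)) := by ring
      _ = K * N₀ ^ (3 / 4 : ℝ) * (n : ℝ) ^ (-(5 / 4) : ℝ) := by
          rw [← Real.rpow_add hn0]; norm_num
  -- bound B: `f n ≤ (1 + K) n^{-1/2}` for `1 ≤ n ≤ N₀`
  have hB : ∀ n : ℕ, 1 ≤ n → (n : ℝ) ≤ N₀ → f n ≤ (1 + K) * (n : ℝ) ^ (-(1 / 2) : ℝ) := by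
    intro n hn hnN
    have hn0 : (0 : ℝ) < n := by exact_mod_cast hn
    have h2 := hV2 n hn
    rw [mul_assoc, hratio2 n hn] at h2
    have hle1 : (n : ℝ) ^ (1 / 4 : ℝ) * N₀ ^ (-(1 / 4) : ℝ) ≤ 1 := by
      rw [Real.rpow_neg hN₀0.le, ← div_eq_mul_inv, div_le_one (Real.rpow_pos_of_pos hN₀0 _)]
      exact Real.rpow_le_rpow hn0.le hnN (by norm_num)
    have hV : ‖V n‖ ≤ 1 + K := by
      calc ‖V n‖ ≤ 1 + K * ((n : ℝ) ^ (1 / 4 : ℝ) * N₀ ^ (-(1 / 4) : ℝ)) := h2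
        _ ≤ 1 + K * 1 := by gcongr
        _ = 1 + K := by ring
    calc f n ≤ ‖V n‖ * (n : ℝ) ^ (-(1 / 2) : ℝ) := hfn n hn
      _ ≤ (1 + K) * (n : ℝ) ^ (-(1 / 2) : ℝ) :=
          mul_le_mul_of_nonneg_right hV (Real.rpow_nonneg hn0.le _)
  -- summability, by bound A
  have hsum : Summable f := by
    have hg : Summable fun n : ℕ => K * N₀ ^ (3 / 4 : ℝ) * (n : ℝ) ^ (-(5 / 4) : ℝ) :=
      (Real.summable_nat_rpow.2 (by norm_num)).mul_left _
    refine Summable.of_nonneg_of_le hfnn (fun n => ?_) hg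
    rcases Nat.eq_zero_or_pos n with h0 | hpos
    · subst h0; rw [hf0]; simp
    · exact hA n hpos
  refine ⟨hsum, ?_⟩
  -- partial sums
  set m : ℕ := ⌊N₀⌋₊ with hm
  have hmN : (m : ℝ) ≤ N₀ := Nat.floor_le hN₀0.le
  have hsqrt0 : 0 ≤ Real.sqrt N₀ := Real.sqrt_nonneg _
  -- first block: `Σ_{1 ≤ n ≤ m} (1+K) n^{-1/2} ≤ 2(1+K)√N₀`
  have hblock1 : ∑ n ∈ Finset.Icc 1 m, f n ≤ 2 * (1 + K) * Real.sqrt N₀ := by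
    calc ∑ n ∈ Finset.Icc 1 m, f n ≤ ∑ n ∈ Finset.Icc 1 m, (1 + K) * (n : ℝ) ^ (-(1 / 2) : ℝ) := by
          refine Finset.sum_le_sum fun n hn => ?_
          rw [Finset.mem_Icc] at hn
          exact hB n hn.1 (le_trans (by exact_mod_cast hn.2) hmN)
      _ = (1 + K) * ∑ n ∈ Finset.Icc 1 m, (n : ℝ) ^ (-(1 / 2) : ℝ) := by rw [Finset.mul_sum]
      _ ≤ (1 + K) * (2 * Real.sqrt m) :=
          mul_le_mul_of_nonneg_left (AFE.sum_Icc_rpow_neg_half_le m) (by linarith)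
      _ ≤ (1 + K) * (2 * Real.sqrt N₀) := by gcongr
      _ = _ := by ring
  -- second block: `Σ_{m < n ≤ M} K N₀^{3/4} n^{-5/4} ≤ 8K√N₀`
  have hblock2 : ∀ M : ℕ, ∑ n ∈ Finset.Ioc m M, f n ≤ 8 * K * Real.sqrt N₀ := by
    intro M
    have hstep : ∑ n ∈ Finset.Ioc m M, f n ≤
        K * N₀ ^ (3 / 4 : ℝ) * ∑ n ∈ Finset.Ioc m M, (n : ℝ) ^ (-(5 / 4) : ℝ) := by
      rw [Finset.mul_sum]
      refine Finset.sum_le_sum fun n hn => ?_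
      rw [Finset.mem_Ioc] at hn
      exact hA n (by omega)
    refine hstep.trans ?_
    have hKN : 0 ≤ K * N₀ ^ (3 / 4 : ℝ) := by positivity
    rcases Nat.eq_zero_or_pos m with hm0 | hmpos
    · -- `N₀ < 1`: the whole tail is `≤ 5`, and `N₀^{3/4} ≤ √N₀`
      have hN1 : N₀ < 1 := by
        have := Nat.lt_floor_add_one N₀; rw [← hm, hm0] at this; simpa using this
      have htail : ∑ n ∈ Finset.Ioc m M, (n : ℝ) ^ (-(5 / 4) : ℝ) ≤ 5 := by
        rw [hm0]
        rcases Nat.eq_zero_or_pos M with hM0 | hMpos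
        · rw [hM0]; simp
        · rw [← Finset.sum_Ioc_consecutive _ (Nat.zero_le 1) hMpos,
            show Finset.Ioc 0 1 = {1} by rfl, Finset.sum_singleton, Nat.cast_one, Real.one_rpow]
          have := Literature.NumberTheory.Sieve.GPY.sum_Ioc_rpow_neg_le (N := 1) (M := M) le_rfl
            (a := 5 / 4) (by norm_num)
          rw [Nat.cast_one, Real.one_rpow] at this
          norm_num at this
          linarith
      have h34 : N₀ ^ (3 / 4 : ℝ) ≤ Real.sqrt N₀ := by
        rw [Real.sqrt_eq_rpow]
        exact Real.rpow_le_rpow_of_exponent_ge hN₀0 hN1.le (by norm_num)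
      calc K * N₀ ^ (3 / 4 : ℝ) * ∑ n ∈ Finset.Ioc m M, (n : ℝ) ^ (-(5 / 4) : ℝ)
          ≤ K * N₀ ^ (3 / 4 : ℝ) * 5 := mul_le_mul_of_nonneg_left htail hKN
        _ ≤ K * Real.sqrt N₀ * 5 := by gcongr
        _ ≤ 8 * K * Real.sqrt N₀ := by nlinarith [mul_nonneg hK hsqrt0]
    · -- `m ≥ 1`: `Σ_{n > m} n^{-5/4} ≤ 4 m^{-1/4} ≤ 8 N₀^{-1/4}`
      have hm1 : 1 ≤ m := hmpos
      have hm0 : (0 : ℝ) < m := by exact_mod_cast hmpos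
      have htail := Literature.NumberTheory.Sieve.GPY.sum_Ioc_rpow_neg_le (N := m) (M := M) hm1
        (a := 5 / 4) (by norm_num)
      have e1 : (m : ℝ) ^ (1 - 5 / 4 : ℝ) / (5 / 4 - 1) = 4 * (m : ℝ) ^ (-(1 / 4) : ℝ) := by
        rw [show (1 - 5 / 4 : ℝ) = -(1 / 4) by norm_num, show (5 / 4 - 1 : ℝ) = 1 / 4 by norm_num]
        ring
      rw [e1] at htail
      -- `m ≥ N₀/2`
      have hmhalf : N₀ / 2 ≤ m := by
        have := Nat.lt_floor_add_one N₀
        rw [← hm] at this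
        have hm1' : (1 : ℝ) ≤ m := by exact_mod_cast hm1
        linarith
      have hm14 : (m : ℝ) ^ (-(1 / 4) : ℝ) ≤ 2 * N₀ ^ (-(1 / 4) : ℝ) := by
        calc (m : ℝ) ^ (-(1 / 4) : ℝ) ≤ (N₀ / 2) ^ (-(1 / 4) : ℝ) :=
              Real.rpow_le_rpow_of_nonpos (by positivity) hmhalf (by norm_num)
          _ = N₀ ^ (-(1 / 4) : ℝ) * (2 : ℝ) ^ (1 / 4 : ℝ) := by
              rw [Real.div_rpow hN₀0.le (by norm_num), Real.rpow_neg (by norm_num : (0:ℝ) ≤ 2),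
                div_eq_mul_inv, inv_inv]
          _ ≤ N₀ ^ (-(1 / 4) : ℝ) * 2 := by
              gcongr
              calc (2 : ℝ) ^ (1 / 4 : ℝ) ≤ (2 : ℝ) ^ (1 : ℝ) :=
                    Real.rpow_le_rpow_of_exponent_le (by norm_num) (by norm_num)
                _ = 2 := Real.rpow_one 2
          _ = _ := by ring
      have hprod : N₀ ^ (3 / 4 : ℝ) * N₀ ^ (-(1 / 4) : ℝ) = Real.sqrt N₀ := by
        rw [← Real.rpow_add hN₀0, Real.sqrt_eq_rpow]; norm_num
      calc K * N₀ ^ (3 / 4 : ℝ) * ∑ n ∈ Finset.Ioc m M, (n : ℝ) ^ (-(5 / 4) : ℝ)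
          ≤ K * N₀ ^ (3 / 4 : ℝ) * (4 * (m : ℝ) ^ (-(1 / 4) : ℝ)) :=
            mul_le_mul_of_nonneg_left htail hKN
        _ ≤ K * N₀ ^ (3 / 4 : ℝ) * (4 * (2 * N₀ ^ (-(1 / 4) : ℝ))) := by gcongr
        _ = 8 * K * (N₀ ^ (3 / 4 : ℝ) * N₀ ^ (-(1 / 4) : ℝ)) := by ring
        _ = 8 * K * Real.sqrt N₀ := by rw [hprod]
  -- partial sums `Σ_{n < M} f n ≤ (2 + 10K) √N₀`
  have hpartial : ∀ M : ℕ, ∑ n ∈ Finset.range M, f n ≤ (2 + 10 * K) * Real.sqrt N₀ := by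
    intro M
    have hsub : Finset.range M ⊆ insert 0 (Finset.Icc 1 m ∪ Finset.Ioc m M) := by
      intro n hn
      rw [Finset.mem_range] at hn
      rw [Finset.mem_insert, Finset.mem_union, Finset.mem_Icc, Finset.mem_Ioc]
      omega
    have hdisj : Disjoint (Finset.Icc 1 m) (Finset.Ioc m M) := by
      rw [Finset.disjoint_left]
      intro n hn1 hn2
      rw [Finset.mem_Icc] at hn1
      rw [Finset.mem_Ioc] at hn2
      omega
    have h0 : (0 : ℕ) ∉ Finset.Icc 1 m ∪ Finset.Ioc m M := by
      simp [Finset.mem_union, Finset.mem_Icc, Finset.mem_Ioc]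
    calc ∑ n ∈ Finset.range M, f n ≤ ∑ n ∈ insert 0 (Finset.Icc 1 m ∪ Finset.Ioc m M), f n :=
          Finset.sum_le_sum_of_subset_of_nonneg hsub fun n _ _ => hfnn n
      _ = f 0 + (∑ n ∈ Finset.Icc 1 m, f n + ∑ n ∈ Finset.Ioc m M, f n) := by
          rw [Finset.sum_insert h0, Finset.sum_union hdisj]
      _ ≤ 0 + (2 * (1 + K) * Real.sqrt N₀ + 8 * K * Real.sqrt N₀) := by
          rw [hf0]; linarith [hblock1, hblock2 M]
      _ = (2 + 10 * K) * Real.sqrt N₀ := by ring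
  rw [← hsqrtN]
  exact Real.tsum_le_of_sum_range_le hfnn hpartial

end Literature.NumberTheory.LFunctions.DirichletConvexity

end
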